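import Summits.Ventures.HodgeRepro.FaceLatticeCore

/-!
# Lemma L, part 2: the zero-sum lattice of CM types is generated by conjugate pairs and census faces

Blind re-derivation cell `pub-hodge-repro`, seat `typer-2`.  Mathlib + `FaceLatticeCore` only.

**Main theorem** `span_pairs_faces_eq_zeroSum`: for `m ≥ 1`, `Submodule.span ℤ (pairs m ∪ faces m) = zeroSum m`
— the lattice `Z` of zero-sum `ℤ`-combinations of CM types (`FaceLatticeCore`: sign vectors `Fin m → Bool`,
`zeroSum`) is generated by the pairs `T + T̄` and the census faces `(Φ; p, p′)` with corners
`Φ, flip p Φ̄, flip p′ Φ̄, flip p′ (flip p Φ)`, `p ≠ p′`.  This SHARPENS the lead's Lemma L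
(route/lattice-lead-g18/LEMMA-L-P.md, whose generators are all zero-sum 4-multisets without a conjugate
pair): the census faces alone, with the pairs, generate `Z` for every `m ≥ 1`.

**Proof** (the lead's induction, made formal).  Modulo the pairs every class is supported on the half-cube
`T 0 = true` (`zeroSum_le_span`).  For `x` zero-sum and supported on a subcube (coordinates in `S ≠ ∅`
frozen to `σ`, `Supp`), freeze one more coordinate `l`: the lower facet `T l = false` has mass `0`
(`sum_restr_false_eq_zero`), hence is a combination of EDGES of that facet (`edge_span`: the cube graph is
connected, proved by freezing coordinates one at a time); the vertical squares on those edges (`Ψ l`,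
`Ψ_edge`) kill the lower facet at the cost of squares `sq T l k`, and the rest lives on the upper facet,
where the induction hypothesis applies (`square_span`).  A square is a face modulo two pairs (`sq_eq`).
Only ADJACENT vertical rectangles are used — this is why the census faces suffice.
-/

namespace HodgeRepro.FaceLattice

open Finset

variable {m : ℕ}

/-! ### Restriction to a facet and support on a subcube -/

/-- The restriction of `x` to the facet `T l = b`. -/
def restr (l : Fin m) (b : Bool) (x : CMType m → ℤ) : CMType m → ℤ := fun T => if T l = b then x T else 0

/-- `x` is supported on the subcube where the coordinates in `S` are frozen to `σ`. -/
def Supp (S : Finset (Fin m)) (σ : CMType m) (x : CMType m → ℤ) : Prop :=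
  ∀ T, x T ≠ 0 → ∀ i ∈ S, T i = σ i

/-- The total mass of `Ψ l y` vanishes. -/
theorem sum_Ψ (l : Fin m) (y : CMType m → ℤ) : ∑ T, Ψ l y T = 0 := by
  have : ∑ T, y (flip l T) = ∑ T, y T := Equiv.sum_comp (flipPerm l) y
  simp only [Ψ_apply, Finset.sum_sub_distrib, this, sub_self]

/-- The shifted combination `x - Ψ l (restr l false x)`, pointwise. -/
theorem shift_apply (l : Fin m) (x : CMType m → ℤ) (T : CMType m) :
    (x - Ψ l (restr l false x)) T = if T l = true then x T + x (flip l T) else 0 := by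
  rw [Pi.sub_apply, Ψ_apply]
  cases hT : T l <;> simp [restr, hT]

/-- Freezing one more coordinate: the shift is supported on the upper facet. -/
theorem Supp_shift {S : Finset (Fin m)} {σ : CMType m} {x : CMType m → ℤ} {l : Fin m}
    (hS : Supp S σ x) (hl : l ∉ S) :
    Supp (insert l S) (Function.update σ l true) (x - Ψ l (restr l false x)) := by
  intro T hT i hi
  rw [shift_apply] at hT
  cases hTl : T l
  · simp [hTl] at hT
  · simp only [hTl, if_true] at hT
    rcases Finset.mem_insert.mp hi with rfl | hiS
    · simp [hTl]
    · have hil : i ≠ l := fun h => hl (h ▸ hiS)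
      rw [Function.update_of_ne hil]
      by_cases hx : x T = 0
      · rw [hx, zero_add] at hT
        rw [← flip_apply_of_ne hil T]
        exact hS _ hT i hiS
      · exact hS _ hx i hiS

/-- The lower facet of a supported combination is supported on the smaller subcube. -/
theorem Supp_restr {S : Finset (Fin m)} {σ : CMType m} {x : CMType m → ℤ} {l : Fin m}
    (hS : Supp S σ x) (hl : l ∉ S) (b : Bool) :
    Supp (insert l S) (Function.update σ l b) (restr l b x) := by
  intro T hT i hi
  simp only [restr] at hT
  split_ifs at hT with hTl
  · rcases Finset.mem_insert.mp hi with rfl | hiS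
    · simp [hTl]
    · have hil : i ≠ l := fun h => hl (h ▸ hiS)
      rw [Function.update_of_ne hil]
      exact hS _ hT i hiS
  · exact absurd rfl hT

/-- A combination supported on the point `σ` vanishes away from `σ`. -/
theorem apply_eq_zero_of_Supp_univ {σ : CMType m} {x : CMType m → ℤ} (hS : Supp Finset.univ σ x)
    {T : CMType m} (hT : T ≠ σ) : x T = 0 := by
  by_contra hx
  exact hT (funext fun i => hS T hx i (Finset.mem_univ i))

/-- A combination supported on a point with vanishing coefficient there is zero. -/
theorem eq_zero_of_Supp_univ {σ : CMType m} {x : CMType m → ℤ} (hS : Supp Finset.univ σ x)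
    (h0 : x σ = 0) : x = 0 := by
  funext T
  by_cases hT : T = σ
  · subst hT; exact h0
  · exact apply_eq_zero_of_Supp_univ hS hT

/-- The sum of a combination supported on a point. -/
theorem sum_eq_of_Supp_univ {σ : CMType m} {x : CMType m → ℤ} (hS : Supp Finset.univ σ x) :
    ∑ T, x T = x σ :=
  Finset.sum_eq_single σ (fun T _ hT => apply_eq_zero_of_Supp_univ hS hT) (by simp)

/-- The weight of a combination supported on a point. -/
theorem weight_eq_of_Supp_univ {σ : CMType m} {x : CMType m → ℤ} (hS : Supp Finset.univ σ x)
    (i : Fin m) : weight i x = x σ * sgn (σ i) := by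
  rw [weight_apply]
  exact Finset.sum_eq_single σ (fun T _ hT => by simp [apply_eq_zero_of_Supp_univ hS hT]) (by simp)

/-- The free set of `insert l S` has one element less. -/
theorem card_compl_insert {S : Finset (Fin m)} {l : Fin m} (hl : l ∈ Sᶜ) :
    (insert l S)ᶜ.card = Sᶜ.card - 1 := by
  rw [Finset.compl_insert, Finset.card_erase_of_mem hl]

/-! ### The edge lemma: zero-mass combinations on a subcube are spanned by its edges -/

/-- Zero-mass combinations supported on a subcube are `ℤ`-combinations of edges of that subcube
(the cube graph is connected). -/
theorem edge_span : ∀ (n : ℕ) (S : Finset (Fin m)), Sᶜ.card = n → ∀ (σ : CMType m) (x : CMType m → ℤ),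
    Supp S σ x → ∑ T, x T = 0 → x ∈ Submodule.span ℤ (edges S) := by
  intro n
  induction n with
  | zero =>
    intro S hS σ x hx hsum
    obtain rfl : S = Finset.univ := (Finset.compl_eq_empty_iff S).mp (Finset.card_eq_zero.mp hS)
    rw [sum_eq_of_Supp_univ hx] at hsum
    rw [eq_zero_of_Supp_univ hx hsum]
    exact Submodule.zero_mem _
  | succ n ih =>
    intro S hS σ x hx hsum
    obtain ⟨l, hl⟩ : Sᶜ.Nonempty := Finset.card_pos.mp (by omega)
    have hlS : l ∉ S := Finset.mem_compl.mp hl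
    have hS' : (insert l S)ᶜ.card = n := by rw [card_compl_insert hl, hS]; rfl
    -- the vertical part lies in the span of the edges in the direction `l`
    have hΨ : Ψ l (restr l false x) ∈ Submodule.span ℤ (edges S) :=
      map_mem_span (Ψ l) (fun T => by rw [Ψ_e]; exact Submodule.subset_span ⟨T, l, hlS, rfl⟩) _
    -- the shifted combination lives on the upper facet and has zero mass
    have hsum' : ∑ T, (x - Ψ l (restr l false x)) T = 0 := by
      simp only [Pi.sub_apply, Finset.sum_sub_distrib, sum_Ψ, hsum, sub_zero]
    have hmem := ih (insert l S) hS' _ _ (Supp_shift hx hlS) hsum'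
    have hmono : Submodule.span ℤ (edges (insert l S)) ≤ Submodule.span ℤ (edges S) := by
      refine Submodule.span_mono ?_
      rintro _ ⟨T, k, hk, rfl⟩
      exact ⟨T, k, fun h => hk (Finset.mem_insert_of_mem h), rfl⟩
    simpa using Submodule.add_mem _ (hmono hmem) hΨ

/-! ### The square lemma: zero-sum combinations on a proper subcube are spanned by squares -/

/-- At a frozen place `i ∈ S` the weight of a supported combination is `sgn (σ i)` times its mass. -/
theorem weight_eq_of_Supp {S : Finset (Fin m)} {σ : CMType m} {x : CMType m → ℤ} (hS : Supp S σ x)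
    {i : Fin m} (hi : i ∈ S) : weight i x = sgn (σ i) * ∑ T, x T := by
  rw [weight_apply, Finset.mul_sum]
  refine Finset.sum_congr rfl fun T _ => ?_
  by_cases hx : x T = 0
  · simp [hx]
  · rw [hS T hx i hi, mul_comm]

/-- The weight at a place `l` is the mass of the upper facet minus the mass of the lower facet. -/
theorem weight_eq_restr (l : Fin m) (x : CMType m → ℤ) :
    weight l x = ∑ T, restr l true x T - ∑ T, restr l false x T := by
  rw [weight_apply, ← Finset.sum_sub_distrib]
  refine Finset.sum_congr rfl fun T _ => ?_
  cases hT : T l <;> simp [restr, hT, sgn]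

/-- The mass is the sum of the masses of the two facets. -/
theorem sum_eq_restr (l : Fin m) (x : CMType m → ℤ) :
    ∑ T, x T = ∑ T, restr l true x T + ∑ T, restr l false x T := by
  rw [← Finset.sum_add_distrib]
  refine Finset.sum_congr rfl fun T _ => ?_
  cases hT : T l <;> simp [restr, hT]

/-- On a proper subcube, the lower facet of a zero-sum combination has zero mass. -/
theorem sum_restr_false_eq_zero {S : Finset (Fin m)} {σ : CMType m} {x : CMType m → ℤ}
    (hS : Supp S σ x) (hne : S.Nonempty) (hz : x ∈ zeroSum m) (l : Fin m) :
    ∑ T, restr l false x T = 0 := by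
  obtain ⟨i, hi⟩ := hne
  have h1 := (mem_zeroSum.mp hz) l
  have h2 := (mem_zeroSum.mp hz) i
  rw [weight_eq_restr] at h1
  rw [weight_eq_of_Supp hS hi, sum_eq_restr l] at h2
  have h3 := (mul_eq_zero.mp h2).resolve_left (sgn_ne_zero _)
  omega

/-- Zero-sum combinations supported on a proper subcube (`S ≠ ∅`) are `ℤ`-combinations of squares. -/
theorem square_span : ∀ (n : ℕ) (S : Finset (Fin m)), Sᶜ.card = n → S.Nonempty →
    ∀ (σ : CMType m) (x : CMType m → ℤ), Supp S σ x → x ∈ zeroSum m →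
    x ∈ Submodule.span ℤ (squares m) := by
  intro n
  induction n with
  | zero =>
    intro S hS hne σ x hx hz
    obtain rfl : S = Finset.univ := (Finset.compl_eq_empty_iff S).mp (Finset.card_eq_zero.mp hS)
    obtain ⟨i, -⟩ := hne
    have h := (mem_zeroSum.mp hz) i
    rw [weight_eq_of_Supp_univ hx] at h
    rw [eq_zero_of_Supp_univ hx ((mul_eq_zero.mp h).resolve_right (sgn_ne_zero _))]
    exact Submodule.zero_mem _
  | succ n ih =>
    intro S hS hne σ x hx hz
    obtain ⟨l, hl⟩ : Sᶜ.Nonempty := Finset.card_pos.mp (by omega)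
    have hlS : l ∉ S := Finset.mem_compl.mp hl
    have hS' : (insert l S)ᶜ.card = n := by rw [card_compl_insert hl, hS]; rfl
    -- the lower facet has zero mass, hence is a combination of its edges
    have hlow : restr l false x ∈ Submodule.span ℤ (edges (insert l S)) :=
      edge_span n (insert l S) hS' _ _ (Supp_restr hx hlS false) (sum_restr_false_eq_zero hx hne hz l)
    -- `Ψ l` sends those edges to squares
    have hΨ : Ψ l (restr l false x) ∈ Submodule.span ℤ (squares m) := by
      have := Submodule.mem_map_of_mem (f := Ψ l) hlow
      rw [Submodule.map_span] at this
      refine Submodule.span_mono ?_ this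
      rintro _ ⟨_, ⟨T, k, hk, rfl⟩, rfl⟩
      exact ⟨T, l, k, fun h => hk (h ▸ Finset.mem_insert_self l S), Ψ_edge l k T⟩
    -- the shifted combination lives on the upper facet and is zero-sum
    have hz' : x - Ψ l (restr l false x) ∈ zeroSum m :=
      Submodule.sub_mem _ hz (span_le (squares_span_le hΨ))
    have hmem := ih (insert l S) hS' (Finset.insert_nonempty l S) _ _ (Supp_shift hx hlS) hz'
    simpa using Submodule.add_mem _ hmem hΨ

/-! ### Lemma L -/

/-- The hard inclusion: every zero-sum combination is a `ℤ`-combination of pairs and faces (`m ≥ 1`). -/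
theorem zeroSum_le_span (hm : 0 < m) : zeroSum m ≤ Submodule.span ℤ (pairs m ∪ faces m) := by
  intro x hz
  obtain ⟨l₀⟩ : Nonempty (Fin m) := ⟨⟨0, hm⟩⟩
  -- modulo pairs, move the lower half-cube onto the upper one
  have hP : pairMap (restr l₀ false x) ∈ Submodule.span ℤ (pairs m ∪ faces m) :=
    map_mem_span pairMap (fun T => by rw [pairMap_e]; exact Submodule.subset_span (Or.inl ⟨T, rfl⟩)) _
  have hx' : Supp {l₀} (fun _ => true) (x - pairMap (restr l₀ false x)) := by
    intro T hT i hi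
    rw [Finset.mem_singleton.mp hi]
    rw [Pi.sub_apply, pairMap_apply] at hT
    cases hTl : T l₀
    · simp [restr, hTl] at hT
    · rfl
  have hz' : x - pairMap (restr l₀ false x) ∈ zeroSum m := Submodule.sub_mem _ hz (span_le hP)
  have hsq := square_span ({l₀} : Finset (Fin m))ᶜ.card {l₀} rfl (Finset.singleton_nonempty l₀) _ _ hx' hz'
  simpa using Submodule.add_mem _ (squares_span_le hsq) hP

/-- **Lemma L** (sharpened): for a CM field with `m ≥ 1` infinite places, the lattice of zero-sum
`ℤ`-combinations of CM types is generated by the conjugate pairs `T + T̄` and the census faces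
`(Φ; p, p′)`, `p ≠ p′`, with corners `Φ, flip p Φ̄, flip p′ Φ̄, flip p′ (flip p Φ)`. -/
theorem span_pairs_faces_eq_zeroSum (hm : 0 < m) :
    Submodule.span ℤ (pairs m ∪ faces m) = zeroSum m :=
  le_antisymm span_le (zeroSum_le_span hm)

/-- **Lemma L as the lead states it** follows a fortiori: any set `G` of zero-sum combinations that contains
the census faces (for instance all zero-sum 4-multisets without a conjugate pair) generates `Z` together
with the pairs. -/
theorem span_pairs_union_eq_zeroSum (hm : 0 < m) {G : Set (CMType m → ℤ)} (hG : faces m ⊆ G)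
    (hGz : G ⊆ zeroSum m) : Submodule.span ℤ (pairs m ∪ G) = zeroSum m := by
  refine le_antisymm (Submodule.span_le.mpr (Set.union_subset ?_ hGz)) ?_
  · rintro _ ⟨T, rfl⟩; exact pairVec_mem T
  · rw [← span_pairs_faces_eq_zeroSum hm]
    exact Submodule.span_mono (Set.union_subset_union_right _ hG)

/-! ### Lemma L exactly as stated: the lead's generator set -/

/-- A zero-sum quadruple of types: every place lies in exactly two of `a, b, c, d`. -/
def IsZeroSumQuad (a b c d : CMType m) : Prop := ∀ i, sgn (a i) + sgn (b i) + sgn (c i) + sgn (d i) = 0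

/-- The four types are pairwise distinct. -/
def Distinct (a b c d : CMType m) : Prop := a ≠ b ∧ a ≠ c ∧ a ≠ d ∧ b ≠ c ∧ b ≠ d ∧ c ≠ d

/-- No two of the four types are conjugate. -/
def ConjFree (a b c d : CMType m) : Prop :=
  b ≠ conj a ∧ c ≠ conj a ∧ d ≠ conj a ∧ c ≠ conj b ∧ d ≠ conj b ∧ d ≠ conj c

/-- The lead's RANK-FOUR FACES (`LEMMA-L-P.md`): the zero-sum `4`-multisets without a conjugate pair. -/
def rankFourFaces (m : ℕ) : Set (CMType m → ℤ) :=
  {y | ∃ a b c d, IsZeroSumQuad a b c d ∧ ConjFree a b c d ∧ y = e a + e b + e c + e d}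

/-- Zero-sum quadruples are zero-sum combinations. -/
theorem rankFourFaces_subset_zeroSum : rankFourFaces m ⊆ zeroSum m := by
  rintro _ ⟨a, b, c, d, hz, -, rfl⟩
  rw [SetLike.mem_coe, mem_zeroSum]; intro i
  simp only [map_add, weight_e]; exact hz i

/-- Two types differing at some place are distinct. -/
theorem ne_of_apply_ne {T S : CMType m} (i : Fin m) (h : T i ≠ S i) : T ≠ S := fun hTS => h (hTS ▸ rfl)

/-- A census face is a zero-sum quadruple. -/
theorem faceVec_isZeroSumQuad {p p' : Fin m} (h : p ≠ p') (Φ : CMType m) :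
    IsZeroSumQuad Φ (flip p (conj Φ)) (flip p' (conj Φ)) (flip p' (flip p Φ)) := by
  intro i
  by_cases hp : i = p
  · subst hp; simp [flip_apply_of_ne h]
  · by_cases hp' : i = p'
    · subst hp'; simp [flip_apply_of_ne (Ne.symm h)]
    · simp [flip_apply_of_ne hp, flip_apply_of_ne hp']

/-- For `m ≥ 3` there is a third place. -/
theorem exists_third_place (hm : 3 ≤ m) (p p' : Fin m) : ∃ r : Fin m, r ≠ p ∧ r ≠ p' := by
  have : ({p, p'} : Finset (Fin m)).card < (Finset.univ : Finset (Fin m)).card := by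
    calc ({p, p'} : Finset (Fin m)).card ≤ 2 := Finset.card_le_two
      _ < m := by omega
      _ = (Finset.univ : Finset (Fin m)).card := (Finset.card_fin m).symm
  obtain ⟨r, -, hr⟩ := Finset.exists_mem_notMem_of_card_lt_card this
  exact ⟨r, fun e => hr (by simp [e]), fun e => hr (by simp [e])⟩

/-- For `m ≥ 3` the four corners of a census face are pairwise distinct (the engine's `cornersWF`). -/
theorem faceVec_distinct (hm : 3 ≤ m) {p p' : Fin m} (h : p ≠ p') (Φ : CMType m) :
    Distinct Φ (flip p (conj Φ)) (flip p' (conj Φ)) (flip p' (flip p Φ)) := by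
  obtain ⟨r, hrp, hrp'⟩ := exists_third_place hm p p'
  refine ⟨ne_of_apply_ne r ?_, ne_of_apply_ne r ?_, ne_of_apply_ne p ?_, ne_of_apply_ne p ?_,
    ne_of_apply_ne r ?_, ne_of_apply_ne r ?_⟩ <;>
    simp [flip_apply_of_ne hrp, flip_apply_of_ne hrp', flip_apply_of_ne h]

/-- For `m ≥ 3` no two corners of a census face are conjugate (the engine's `noConjugateCorners`). -/
theorem faceVec_conjFree (hm : 3 ≤ m) {p p' : Fin m} (h : p ≠ p') (Φ : CMType m) :
    ConjFree Φ (flip p (conj Φ)) (flip p' (conj Φ)) (flip p' (flip p Φ)) := by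
  obtain ⟨r, hrp, hrp'⟩ := exists_third_place hm p p'
  refine ⟨ne_of_apply_ne p ?_, ne_of_apply_ne p' ?_, ne_of_apply_ne r ?_, ne_of_apply_ne r ?_,
    ne_of_apply_ne p' ?_, ne_of_apply_ne p ?_⟩ <;>
    simp [flip_apply_of_ne hrp, flip_apply_of_ne hrp', flip_apply_of_ne h, flip_apply_of_ne (Ne.symm h)]

/-- For `m ≥ 3` every census face is one of the lead's rank-four faces. -/
theorem faces_subset_rankFourFaces (hm : 3 ≤ m) : faces m ⊆ rankFourFaces m := by
  rintro _ ⟨Φ, p, p', h, rfl⟩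
  exact ⟨_, _, _, _, faceVec_isZeroSumQuad h Φ, faceVec_conjFree hm h Φ, rfl⟩

/-- **Lemma L exactly as stated** (`LEMMA-L-P.md`): for `m ≥ 3`, the zero-sum lattice is generated by the
conjugate pairs and the zero-sum `4`-multisets without a conjugate pair. -/
theorem span_pairs_rankFourFaces_eq_zeroSum (hm : 3 ≤ m) :
    Submodule.span ℤ (pairs m ∪ rankFourFaces m) = zeroSum m :=
  span_pairs_union_eq_zeroSum (by omega) (faces_subset_rankFourFaces hm) rankFourFaces_subset_zeroSum

end HodgeRepro.FaceLattice
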